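import Mathlib
import HarnessLib
import HarnessLib.Audit
import Summits.AtomisticToContinuum.Statement
import Summits.AtomisticToContinuum.BoseEinsteinCondensation.Theorems.BECRenormGroupAssembly

/-!
Route: BECRenormGroup

CLOSED (retired) 2026-08-15T13:40:06Z by operator:999:1257524 — reason: not-a-thesis: assembly does not conclude the sub-problem Statement — note: D-0027 §2.1 audit (human 2026-08-15: routes that do not decide the summit are removed): the assembly concludes `Literature.MathematicalPhysics.QuantumManyBody.BoseGas.BoseEinsteinCondensation`, not the sub-problem statement; a NEW conforming route may be opened from the same idea (generated `closes . The file is kept as the record of this route; refuted decls are indexed as negative knowledge (`ledger negatives`).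

X_B2 (RG CONTROL OF THE SYMMETRY-BROKEN PHASE; informal): for every repulsive finite-range radial v
there is ρ₀(v) > 0
such that for 0 < ρ < ρ₀ the zero-temperature Bose gas admits a convergent multiscale (Wilsonian
renormalisation
group) representation of its imaginary-time coherent-state functional integral in the periodic box
Λ_L, grand
canonical at chemical potential μ(ρ), with symmetry-breaking source λ·L^{3/2}(a₀ + a₀*), UNIFORMLY
in L and in
λ → 0⁺, whose infrared flow is governed by the Bogoliubov fixed point with the exact cancellations
enforced by the
U(1) Ward identities (no anomalous dimension in the longitudinal/transverse propagators beyond the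
known
logarithmic corrections in d = 3, T = 0); CONSEQUENCE (off-diagonal long-range order):
   lim_{λ→0⁺} liminf_{L→∞} (ρ L³)⁻¹ ⟨a₀* a₀⟩_{L,λ} ≥ 1 − C √(ρ a³).
Together with the TRANSFER statement (grand-canonical/periodic/symmetry-broken ODLRO ⇒
canonical/Dirichlet
zero-mode occupation of energy near-minimisers, i.e. route BECInfraredBound's X_B1) this gives
BoseEinsteinCondensation.
Lean: X_B2 is not typable today (no functional-integral representation, no second quantisation in
the library);
its typable consequence is X_B1 (stmt bec_zero_mode_thesis, attached at rank 1 as this route's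
assembly target):
∀ v, IsRepulsiveFiniteRange v → ∃ ρ₀ > 0, ∀ ρ ∈ (0,ρ₀), ∃ c > 0, ∀ᶠ N, ∃ δ > 0, ∀ Ψ
δ-near-minimiser,
  ofReal (c N) ≤ occupation N φ₀ Ψ.ψ   (exact term: see BECInfraredBound thesis).

Rationale: WHY THIS LINE. BEC at positive density is an infrared problem of a system with a spontaneously
broken continuous
symmetry; the physics answer (Bogoliubov 1947; Benfatto arXiv:cond-mat/9410004 "Renormalization
group approach to
zero temperature Bose condensation"; Castellani–Di Castro–Pistolesi–Strinati 1997) is a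
renormalisation-group
flow to a nontrivial but exactly-controlled fixed point where Ward identities cancel the apparent
infrared
divergences — d = 3, T = 0 is the MARGINAL case (3+1 dimensions). Constructive QFT has made this
rigorous in
fermionic analogues (BenfattoGiulianiMastropietro2006-style multiscale expansions with Ward
identities) and, for
bosons, Balaban–Feldman–Knörrer–Trubowitz carried out the temporal-ultraviolet and small-field parts
of exactly
this programme (Ann. Henri Poincaré 11 (2010) doi:10.1007/s00023-010-0028-5; J. Stat. Phys. 2008
doi:10.1007/s10955-008-9634-8; J. Math. Phys. 2010 doi:10.1063/1.3329425). PROBLEMS.md §3 names this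
programme.
Area imported: constructive renormalisation (multiscale cluster expansions, large-field domination,
Ward
identities). Physical analogy dictionary: [Goldstone mode] ↦ [phase field with propagator 1/(ω² +
c²p²)];
[condensate fraction] ↦ [(ρL³)⁻¹⟨a₀*a₀⟩ at λ → 0⁺ after L → ∞]; [BEC criterion of the conjunct] ↦
[X_B1 via transfer].

RANKED CRUXES (all informal; nothing here elaborates today):
 2. INFRARED CONVERGENCE: bounded RG flow to all scales for the symmetry-broken bosonic action at T
= 0, d = 3,
    with Ward-identity cancellations proved non-perturbatively (Benfatto's one-loop scheme made
convergent) —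
    the hardest step; includes control of the marginal logarithms.
 3. LARGE-FIELD PROBLEM: stability/large-field domination for the complex bosonic effective actions
beyond the
    small-field region treated by Balaban–FKT.
 4. TRANSFER: ODLRO in the grand-canonical periodic symmetry-broken state ⇒ X_B1 (canonical,
Dirichlet,
    near-minimisers): equivalence of ensembles at T = 0, Griffiths-type convexity argument in λ,
insensitivity of
    the condensate fraction to boundary conditions (LSSY2005 Ch. 2 remark after (2.8) for the
energy).
 5. = X_B1 → BoseEinsteinCondensation (BECInfraredBound crux 4, attached).
KILL CRITERIA: none by refutation of a formal item yet (route is informal); close if crux 2 is shown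
to require an
uncontrolled (strong-coupling) fixed point for some admissible v at arbitrarily small ρ, or if
TRANSFER (4) is
refuted (Dirichlet near-minimisers not condensing in φ₀ while ODLRO holds).
NOT DECOMPOSED (deliberately): the functional-integral representation as a Lean object (would need
coherent-state
path measures); positive temperature; the UV end (done by Balaban–FKT, to be cited when a statement
exists).
DEFINITION REQUESTS: none filed now — typing X_B2 needs a second-quantised Bose gas layer (Fock
space, a_p, grand
canonical Gibbs/ground state); requested informally here, to be filed when crux 4 is taken up.
SOURCES: Benfatto arXiv:cond-mat/9410004; Balaban–Feldman–Knörrer–Trubowitz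
doi:10.1007/s00023-010-0028-5,
doi:10.1007/s10955-008-9634-8; BenfattoGiulianiMastropietro2006; LSSY2005 §1.2, Ch. 2, Ch. 5.

Novelty: NOVELTY (route-repair planner, 2026-08-15). Searches RUN before this claim: `lit search --hybrid
"renormalization group zero temperature Bose condensation Ward identities symmetry breaking"` (15
held books — Griffin1993, DiCastroRaimondi2015, LSSY2005, Zinn-Justin 2007, Altland–Simons …; no
rigorous construction); `lit search --source local "Balaban Feldman Knörrer Trubowitz complex
bosonic many-body"` (1 hit: Oberwolfach Report 2016, Feldman's talk); the remote cascade
(OpenAlex/S2/arXiv) timed out in this pass (searchd rc 75, twice); `lit frontier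
AtomisticToContinuum --since 2020` (30 descendants; every BEC entry is an energy /
kinetic-localisation paper — arXiv:2510.20493, arXiv:2603.20776, arXiv:2602.16566, arXiv:2605.06844
— none RG-based); `lit bridges AtomisticToContinuum --cross any` (RG-relevant bridges:
arXiv:2209.11714 Basti–Caraci–Cenatiempo review and arXiv:1211.3772 Cenatiempo thesis, both citing
Benfatto1994 / BFKT2017 / CenatiempoGiuliani2014 × the Benfatto–Giuliani–Mastropietro roots of
HubbardSuperconductivity); `lit galaxy search "complex bosonic many-body models" --star all` (2
scanned books: Les Houches 2010 'Quantum Theory from Small to Large Scales' with the BFKT lectures,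
panama:296825189826608; 'Macroscopic Limits of Quantum Systems' (2018) with Pizzo's chapter,
panama:299728587718706; pdf / crabby 0) and `lit galaxy search "renormalization group approach to
zero temperature Bose condensation" --star all` (0); `lit read` arXiv:cond-mat/9410004 pp. 2,  [refs: 10.1007/3-540-59190-7_31, 10.1007/s00023-010-0028-5, 10.1063/1.3329425, 2510.20493, 2603.20776, 2602.16566, 2605.06844, 2209.11714, 1211.3772, cond-mat/9410004, 1609.00968, 1609.01745, 1404.5233, 1511.07022, 1106.4921, cond-mat/0310306, math-ph/0412023, cond-mat/0412440, 1704.00190, doi:10.1007/3-540-59190-7_31, doi:10.1007/s00023-010-0028-5, doi:10.1063/1.3329425, Griffin1993, DiCastroRaimondi201]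

Barriers (technique_class: constructive-rg, ward-identities, large-field, quasi-average): - technique_class: constructive-rg, ward-identities, large-field, quasi-average
- Literature.Barriers.AtomisticToContinuum.BogoliubovPerturbationInfrared: APPLIES by name — its
block cites this route and its technique_class lists renormalization-group / wilsonian-rg /
multiscale-expansion / cluster-expansion / functional-integral / ward-identities / small-field /
large-field / constructive-rg. Evasion exactly as recorded in the entry's own narrowing
(BogoliubovPerturbationInfraredNarrow, evasion (iii) and caveat (c)): the line never truncates the
particle-representation expansion at finite order; the d = 3 logarithms (Σ₁₂ ~ 1/ln|ω² − c²Q²|; the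
GN bubble ∫G_c² = 4|B⁴| log(1/δ), integral_shell_norm_rpow_neg_four) are organised by the Wilsonian
flow with running couplings plus the U(1) Ward identities, i.e. the two-derivative (s = 2) vertex
counting that is finite in d = 3 (integrableOn_mul_bubbleIntegrand vs
not_integrableOn_rpow_mul_bubbleIntegrand). What the entry leaves standing — 'the missing piece of
that programme is the large-field problem … an open problem rather than a no-go' — is NOT evaded: it
is filed as cruxes BecRgLargeField (0694) and BecRgInfraredConvergence (0693). The bet is that a
small-field/large-field decomposition for COMPLEX bosonic effective actions can be completed
(Benfatto §1: 'I do not expect this is a trivial generalization of known techniques').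
- Literature.Barriers.AtomisticToContinuum.BogoliubovPerturbationInfraredNarrow: as the previous
line;

History (route lifecycle, newest last):
- 2026-08-15T13:40:06Z · CLOSED retired — not-a-thesis: assembly does not conclude the sub-problem Statement (operator:999:1257524)

sub-problem: BoseEinsteinCondensation · status: closed(retired) · opened planner-AtomisticToContinuum-Survey-0 2026-08-13T13:26:14Z · rev 1 · ledger route-AtomisticToContinuum-BECRenormGroup
GENERATED by the gate from the ledger (D-0016/17). Provers cite these decls: `theorem foo : Summit.AtomisticToContinuum.BoseEinsteinCondensation.Theses.BECRenormGroup.<Decl> := …` in Summits/AtomisticToContinuum/BoseEinsteinCondensation/Theorems/<Name>.lean.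
-/

namespace Summit.AtomisticToContinuum.BoseEinsteinCondensation.Theses.BECRenormGroup

open scoped BigOperators Topology Manifold Classical MeasureTheory ProbabilityTheory Matrix InnerProductSpace ComplexConjugate ContinuousMap
open Filter Set Function TopologicalSpace MeasureTheory

attribute [summit_statement] _root_.BoseEinsteinCondensation

-- item stmt-AtomisticToContinuum-0692 · target · rank 0 · closed · moot by None · by planner — informal only, no Lean statement yet:
--   X_B2: for every repulsive finite-range v and 0 < ρ < ρ₀(v), the T = 0 coherent-state functional
--   integral of the Bose gas (periodic box Λ_L, grand canonical at μ(ρ), symmetry-breaking source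
--   λL^{3/2}(a₀ + a₀*)) has a convergent multiscale RG representation uniform in L and λ → 0⁺, with
--   infrared flow controlled by the Bogoliubov fixed point plus U(1) Ward identities; consequently
--   ODLRO: lim_{λ→0⁺} liminf_{L→∞} (ρL³)⁻¹⟨a₀*a₀⟩_{L,λ} ≥ 1 − C√(ρa³).

/-- item stmt-AtomisticToContinuum-0686 · crux · rank 1 · open · by planner
why it might fail: It is the conjecture itself in Dirichlet constant-mode form, stronger than HasGroundStateBEC: the Dirichlet condensate wave function has a healing-length boundary layer (free gas: φ₀-share (8/π²)³≈0.53), so c must absorb wall artefacts uniformly in N; δ must sit below the N-body gap ~L⁻².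
sources: LSSY2005 §1.2 (1.19) and Ch.5 §5.1 p.42 ('remains open'), arXiv:2011.00309 (Fournais2020) Thm 1.2 and §1 after (1.12), arXiv:2603.20776 (Junge2026) Cor. 6, Literature.Barriers.AtomisticToContinuum.KineticGapLengthScalesNarrow, refuter notes on stmt-AtomisticToContinuum-0689/0733 (Dirichlet boundary layer, (8/π²)³)
X_B1: zero-mode macroscopic occupation. For every repulsive finite-range v, at all small densities
ρ, for all large N there is δ > 0 such that every δ-near-minimiser Ψ of the Dirichlet N-body energy
in the box of side (N/ρ)^{1/3} has ⟨φ₀, γ_Ψ φ₀⟩ ≥ cN for the normalised constant mode φ₀ =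
L^{-3/2}·1_box (c > 0 depending on v, ρ). -/
@[route_item "route-AtomisticToContinuum-BECRenormGroup"]
def BecZeroModeThesis : Prop :=
  ∀ v : ℝ → ENNReal, Literature.MathematicalPhysics.QuantumManyBody.BoseGas.IsRepulsiveFiniteRange v → ∃ ρ₀ : ℝ, 0 < ρ₀ ∧ ∀ ρ : ℝ, 0 < ρ → ρ < ρ₀ → ∃ c : ℝ, 0 < c ∧ ∀ᶠ N : ℕ in Filter.atTop, ∃ δ : ENNReal, 0 < δ ∧ ∀ Ψ : Literature.MathematicalPhysics.QuantumManyBody.BoseGas.TrialState N (Literature.MathematicalPhysics.QuantumManyBody.BoseGas.sideLength ρ N), Literature.MathematicalPhysics.QuantumManyBody.BoseGas.energy v Ψ ≤ Literature.MathematicalPhysics.QuantumManyBody.BoseGas.groundStateEnergy v N (Literature.MathematicalPhysics.QuantumManyBody.BoseGas.sideLength ρ N) + δ → ENNReal.ofReal (c * N) ≤ Literature.MathematicalPhysics.QuantumManyBody.BoseGas.occupation N ((Literature.MathematicalPhysics.QuantumManyBody.BoseGas.box (Literature.MathematicalPhysics.QuantumManyBody.BoseGas.sideLength ρ N)).indicator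 fun _ => ((Real.sqrt (Literature.MathematicalPhysics.QuantumManyBody.BoseGas.sideLength ρ N ^ 3))⁻¹ : ℂ)) Ψ.ψ

-- item stmt-AtomisticToContinuum-0693 · crux · rank 2 · closed · moot by None · by planner — informal only, no Lean statement yet:
--   INFRARED CONVERGENCE (crux of X_B2): the Wilsonian RG flow of the symmetry-broken T = 0 Bose action
--   in d = 3 (marginal, 3+1 dimensions) is bounded on all infrared scales with the running couplings
--   converging to the Bogoliubov fixed point up to the logarithmic corrections dictated by the Ward
--   identities (Benfatto arXiv:cond-mat/9410004 at one loop), and the renormalised expansion for the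
--   two-point function ⟨a_x* a_y⟩ converges uniformly in L, λ → 0⁺, giving |⟨a_x* a_y⟩ − ρ₀| ≤ C√(ρa³)ρ
--   + o_{|x−y|→∞}(1) with ρ₀ ≥ ρ(1 − C√(ρa³)).

-- item stmt-AtomisticToContinuum-0694 · crux · rank 3 · closed · moot by None · by planner — informal only, no Lean statement yet:
--   LARGE-FIELD PROBLEM: stability bounds and large-field domination for the complex bosonic effective
--   actions at every RG scale (the region excluded in Balaban–Feldman–Knörrer–Trubowitz's small-field
--   power-series representation, doi:10.1063/1.3329425), sufficient to sum the multiscale cluster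
--   expansion of crux 2.

-- item stmt-AtomisticToContinuum-0695 · crux · rank 4 · closed · moot by None · by planner — informal only, no Lean statement yet:
--   TRANSFER: ODLRO in the grand-canonical, periodic, symmetry-broken T = 0 state (conclusion of X_B2)
--   implies X_B1 — macroscopic occupation ≥ cN of the normalised constant mode for every
--   δ_N-near-minimiser of the CANONICAL DIRICHLET N-body energy in the box of side (N/ρ)^{1/3}, for ρ <
--   ρ₀ and N large. Ingredients: equivalence of ensembles for the ground-state energy density and for
--   γ⁽¹⁾; Griffiths' convexity argument in λ; boundary-condition insensitivity of the condensate
--   fraction (energy analogue: LSSY2005 Ch. 2 after (2.8)); near-minimiser stability via the spectral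
--   gap of order δ_N.

/-- item stmt-AtomisticToContinuum-0687 · assembly · rank 1 · closed · proved by AtomisticToContinuum.BECRenormGroup.bec_of_zeroMode_rg (refuter) · by planner
X_B1 → BoseEinsteinCondensation: occupation of φ₀ ≤ maxOccupation (occupation_le_maxOccupation, φ₀
measurable and L²-normalised for L > 0), uniform over δ-near-minimisers ⇒ ≤ condensateNumber
(le_condensateNumber) ⇒ HasGroundStateBEC v ρ. -/
@[route_item "route-AtomisticToContinuum-BECRenormGroup"]
def Assembly : Prop :=
  (∀ v : ℝ → ENNReal, Literature.MathematicalPhysics.QuantumManyBody.BoseGas.IsRepulsiveFiniteRange v → ∃ ρ₀ : ℝ, 0 < ρ₀ ∧ ∀ ρ : ℝ, 0 < ρ → ρ < ρ₀ → ∃ c : ℝ, 0 < c ∧ ∀ᶠ N : ℕ in Filter.atTop, ∃ δ : ENNReal, 0 < δ ∧ ∀ Ψ : Literature.MathematicalPhysics.QuantumManyBody.BoseGas.TrialState N (Literature.MathematicalPhysics.QuantumManyBody.BoseGas.sideLength ρ N), Literature.MathematicalPhysics.QuantumManyBody.BoseGas.energy v Ψ ≤ Literature.MathematicalPhysics.QuantumManyBody.BoseGas.groundStateEnergy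 v N (Literature.MathematicalPhysics.QuantumManyBody.BoseGas.sideLength ρ N) + δ → ENNReal.ofReal (c * N) ≤ Literature.MathematicalPhysics.QuantumManyBody.BoseGas.occupation N ((Literature.MathematicalPhysics.QuantumManyBody.BoseGas.box (Literature.MathematicalPhysics.QuantumManyBody.BoseGas.sideLength ρ N)).indicator fun _ => ((Real.sqrt (Literature.MathematicalPhysics.QuantumManyBody.BoseGas.sideLength ρ N ^ 3))⁻¹ : ℂ)) Ψ.ψ) → Literature.MathematicalPhysics.QuantumManyBody.BoseGas.BoseEinsteinCondensation

/-- `Assembly` holds: proved by `AtomisticToContinuum.BECRenormGroup.bec_of_zeroMode_rg`. -/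
theorem Assembly_holds : Assembly := _root_.AtomisticToContinuum.BECRenormGroup.bec_of_zeroMode_rg

end Summit.AtomisticToContinuum.BoseEinsteinCondensation.Theses.BECRenormGroup
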